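import Literature.MathematicalPhysics.KineticTheory.Hilbert6LinearizedBoltzmann
import Literature.Analysis.UnboundedOperators.LinearizedBoltzmannKernelProofs
import HarnessLib

/-!
# The linearised hard-sphere Boltzmann operator on `ℝ^d`: the kernel (proofs)

Topic: MathematicalPhysics / KineticTheory (family `hilbert6`, statement **hilbert6.S19**). Pure
proof file, sibling of `Hilbert6LinearizedBoltzmann.lean` (next to
`Hilbert6LinearizedBoltzmannSymmetryProofs`, which discharges `hardSphereLinearizedOp_symmetric`
and `hardSphereLinearizedOp_nonpos`): discharge of its kernel fact by specialising the velocity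
space of the prelude `Literature/Analysis/UnboundedOperators/LinearizedBoltzmann.lean` (proof file
`…KernelProofs`) to `V d = EuclideanSpace ℝ (Fin d)`, whose dimension is `finrank ℝ (V d) = d`:

* `hardSphereLinearizedOp_eq_zero_iff_mem_collisionInvariants_holds` (CIP 1994 §7.1
  (7.1.10)–(7.1.11), pp. 192–193, with Thm 3.1.1, p. 37; Ellis–Pinsky 1975 Prop. 1.1): in velocity
  dimension `d ≥ 2`, `L g = 0 ↔ g ∈ span {1, v₁, …, v_d, |v|²}` for `g` of temperate growth, from
  `hardSphereLinearizedOp_eq_zero_iff_holds`.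

Not discharged here (they rest on prelude facts that are still open: the Baranger–Mouhot spectral
gap `le_neg_maxwellianInner_hardSphereLinearizedOp_of_orthogonal`, the self-adjoint realisation
`exists_isSelfAdjoint_hasCore`, and `dirichletFormInv_pos_of_orthogonal_of_ne_zero`):
`hardSphereLinearizedOp_spectralGap`, `hardSphereLinearizedOp_selfAdjointRealisation`,
`hardSphereViscosity_pos`, `hardSphereHeatConductivity_pos`.

## References

* C. Cercignani, R. Illner, M. Pulvirenti, *The Mathematical Theory of Dilute Gases*, Applied
  Mathematical Sciences 106, Springer (1994): §7.1 (7.1.6)–(7.1.11), pp. 192–193; §3.1 Thm 3.1.1,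
  p. 37.
* R. S. Ellis, M. A. Pinsky, *The first and second fluid approximations to the linearized
  Boltzmann equation*, J. Math. Pures Appl. 54 (1975) 125–156, Prop. 1.1.
-/

namespace Literature.MathematicalPhysics.KineticTheory

open Literature.Analysis.UnboundedOperators (hardSphereLinearizedOp_eq_zero_iff_holds)

variable {d : ℕ}

/-- **hilbert6.S19, discharge of `hardSphereLinearizedOp_eq_zero_iff_mem_collisionInvariants`**
(CIP 1994 §7.1 (7.1.10)–(7.1.11), pp. 192–193: equality in `(h, Lh) ≤ 0` holds "if and only if
`h'/R' + h_*'/R_*' - h/R - h_*/R_* = 0`, i.e., unless `h/R` is a collision invariant", and these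
span the zero eigenspace of `L`; with the classification of continuous collision invariants,
Thm 3.1.1, p. 37; Ellis–Pinsky 1975 Prop. 1.1). In velocity dimension `d ≥ 2`, a function `g` of
temperate growth on `ℝ^d` satisfies `L g = 0` iff `g ∈ span {1, v₁, …, v_d, |v|²}`: the case
`E = V d` (`finrank ℝ (V d) = d`) of `hardSphereLinearizedOp_eq_zero_iff_holds`.
[cite: CIPDiluteGases1994, §7.1 (7.1.10)–(7.1.11), pp. 192–193, with Thm 3.1.1, p. 37] -/
theorem hardSphereLinearizedOp_eq_zero_iff_mem_collisionInvariants_holds :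
    hardSphereLinearizedOp_eq_zero_iff_mem_collisionInvariants (d := d) := by
  intro hd g hg
  exact hardSphereLinearizedOp_eq_zero_iff_holds (E := V d) (by simpa using hd) hg

end Literature.MathematicalPhysics.KineticTheory
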